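import Summits.KontsevichZagierPeriods.Zeta5Search.Barrier.ConeGammaSkeletonCover
import Summits.KontsevichZagierPeriods.Zeta5Search.Barrier.ConeGammaWindowCoverExt
import Summits.KontsevichZagierPeriods.Zeta5Search.Barrier.ConeGammaAPChainCover
import Summits.KontsevichZagierPeriods.Zeta5Search.Barrier.ConeGammaAPPatchCoverSouth
import Summits.KontsevichZagierPeriods.Zeta5Search.Barrier.ConeGammaTopClassBoxC57b
import Summits.KontsevichZagierPeriods.Zeta5Search.Barrier.ConeGammaTopClassBoxC60b
import Summits.KontsevichZagierPeriods.Zeta5Search.Barrier.ConeGammaTopClassBoxB51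
import Summits.KontsevichZagierPeriods.Zeta5Search.Barrier.ConeGammaTopClassBoxA52
import Summits.KontsevichZagierPeriods.Zeta5Search.Barrier.ConeGammaTopClassBoxC60c
import Summits.KontsevichZagierPeriods.Zeta5Search.Barrier.ConeGammaTopClassBoxC53b
import Summits.KontsevichZagierPeriods.Zeta5Search.Barrier.ConeGammaTopClassBoxC53c
import Summits.KontsevichZagierPeriods.Zeta5Search.Barrier.ConeGammaTopClassBoxC58
import Summits.KontsevichZagierPeriods.Zeta5Search.Barrier.ConeGammaTopClassBoxA34
import Summits.KontsevichZagierPeriods.Zeta5Search.Barrier.ConeGammaTopClassBoxC50b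
import Summits.KontsevichZagierPeriods.Zeta5Search.Barrier.ConeGammaTopClassBoxC56b
import Summits.KontsevichZagierPeriods.Zeta5Search.Barrier.ConeGammaTopClassBoxA49

/-!
# ζ(5) search — BARRIER: ONE NAME FOR THE KERNEL REGIONS — γ ≤ 9476/10⁴ on the union of every r = 1/100 kernel region of the tree

HONEST FRAMING (cell `pub-zeta5`): systematic search; no irrationality claim unless kernel-certified. MODEL objects under Brown–Zudilin's (28)+(30) accounting
([BZ22] = arXiv:2210.03391; (28) observed, not proved): the rate `gamma` of `ConeGammaRates`. WHAT THIS FILE SAYS: `kernelRegions` = the union of the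
sets on which the tree holds a kernel γ-certificate at radius 1/100 — cert-2 g41's skeleton cover `SkelCover.coverUnion` (12 boxes on ℓ, ℓ′, L1 and the four
named points; ≤ 0.9396), g41/g42's strip of 𝔉 `WinCover.windowUnion ∪ WinCover.extUnion` (25 grid boxes; ≤ 0.9380), g42's AP chain `TopBox.apUnion` (7 boxes;
≤ 0.9381), g42's twelve other point boxes at census top classes (≤ 0.9137–0.9337) and cert-2 g43's AP patch `APPatch.apUnionS` (41 lattice boxes; ≤ 0.9476) — and **`gamma_le_kernelRegions : BZBox a → Regular a →
(s/s₀)(a) ∈ kernelRegions → gamma a ≤ 9476/10⁴`** = the maximum of the parts' ceilings, every part BY NAME (two-line corollaries; successor-menu item (e) of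
cert-2 g42/g43 «one name, if a reader wants it»). WHAT IT DOES NOT SAY: a COARSE ceiling (> 0.9) on a union of seven-dimensional tubes and boxes around the hot
structures of BOX-A's census — nothing about the cone off these regions, the cone's supremum (C2 OPEN), the witness sentence, S-E (CONJECTURED), (TD_A) or
`ζ(5)`; no number or sentence of record moves; class-60 words untouched; records in print UNMOVED. Theory seat cert-2 g43; generator `gen/mkregions43.py`.
-/

open Set
open Literature.Analysis.ValidatedNumerics.NumericsMP

noncomputable section

namespace Summit.KontsevichZagierPeriods.Zeta5Search.Barrier.ConeGamma

namespace APPatch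

open LemmaFBox (box)

/-- g42's twelve point boxes at census top classes that are not part of the AP chain (57;9,13,…, 60;10,14,…, 51;9,11,…, 52, 60;12,14,…, 53;7,13,…(2), 58;12,14,18,…, 34, 50;6,12,…, 56;8,14,…, 49). -/
def pointBoxes : Set (Fin 8 → ℝ) :=
  box 5700 TopBox.loBox_c57b_100 TopBox.hiBox_c57b_100 ∪
  box 6000 TopBox.loBox_c60b_100 TopBox.hiBox_c60b_100 ∪
  box 5100 TopBox.loBox_b51_100 TopBox.hiBox_b51_100 ∪
  box 5200 TopBox.loBox_a52_100 TopBox.hiBox_a52_100 ∪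
  box 6000 TopBox.loBox_c60c_100 TopBox.hiBox_c60c_100 ∪
  box 5300 TopBox.loBox_c53b_100 TopBox.hiBox_c53b_100 ∪
  box 5300 TopBox.loBox_c53c_100 TopBox.hiBox_c53c_100 ∪
  box 5800 TopBox.loBox_c58_100 TopBox.hiBox_c58_100 ∪
  box 3400 TopBox.loBox_a34_100 TopBox.hiBox_a34_100 ∪
  box 5000 TopBox.loBox_c50b_100 TopBox.hiBox_c50b_100 ∪
  box 5600 TopBox.loBox_c56b_100 TopBox.hiBox_c56b_100 ∪
  box 4900 TopBox.loBox_a49_100 TopBox.hiBox_a49_100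

/-- **The kernel regions of the tree at radius 1/100**: skeleton cover ∪ strip of 𝔉 ∪ AP chain ∪ point boxes ∪ AP patch. -/
def kernelRegions : Set (Fin 8 → ℝ) :=
  SkelCover.coverUnion ∪ (WinCover.windowUnion ∪ WinCover.extUnion) ∪ TopBox.apUnion ∪ pointBoxes ∪ apUnionS

/-- **`γ(a) ≤ 9476/10⁴` on the kernel regions** — the maximum of the ceilings of `SkelCover.gamma_le_skeleton` (9396), `WinCover.gamma_le_strip` (9380),
`TopBox.gamma_le_apchain` (9381), the twelve `TopBox.gamma_le_box_*` (9337, 9293, 9216, 9319, 9295, 9258, 9272, 9137, 9196, 9249, 9273, 9277) and `APPatch.gamma_le_appatchS` (9476), BY NAME. MODEL `gamma` under BZ (28)+(30); COARSE;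
`Regular a` a hypothesis; nothing about the cone off these regions or its supremum (C2 OPEN). -/
theorem gamma_le_kernelRegions {a : Dir} (ha : BZBox a) (hreg : Regular a)
    (h : (fun i => sParam a i / sParam a 0) ∈ kernelRegions) : gamma a ≤ (9476 : ℝ) / 10000 := by
  unfold kernelRegions pointBoxes at h
  rcases h with ((((hs | hw) | hc) | hp) | hq)
  · exact (SkelCover.gamma_le_skeleton ha hreg hs).trans (by norm_num)
  · exact (WinCover.gamma_le_strip ha hreg hw).trans (by norm_num)
  · exact (TopBox.gamma_le_apchain ha hreg hc).trans (by norm_num)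
  · rcases hp with ((((((((((h | h) | h) | h) | h) | h) | h) | h) | h) | h) | h) | h
    · exact (TopBox.gamma_le_box_c57b_100 ha (fun j => h j.succ) hreg).trans (by norm_num)
    · exact (TopBox.gamma_le_box_c60b_100 ha (fun j => h j.succ) hreg).trans (by norm_num)
    · exact (TopBox.gamma_le_box_b51_100 ha (fun j => h j.succ) hreg).trans (by norm_num)
    · exact (TopBox.gamma_le_box_a52_100 ha (fun j => h j.succ) hreg).trans (by norm_num)
    · exact (TopBox.gamma_le_box_c60c_100 ha (fun j => h j.succ) hreg).trans (by norm_num)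
    · exact (TopBox.gamma_le_box_c53b_100 ha (fun j => h j.succ) hreg).trans (by norm_num)
    · exact (TopBox.gamma_le_box_c53c_100 ha (fun j => h j.succ) hreg).trans (by norm_num)
    · exact (TopBox.gamma_le_box_c58_100 ha (fun j => h j.succ) hreg).trans (by norm_num)
    · exact (TopBox.gamma_le_box_a34_100 ha (fun j => h j.succ) hreg).trans (by norm_num)
    · exact (TopBox.gamma_le_box_c50b_100 ha (fun j => h j.succ) hreg).trans (by norm_num)
    · exact (TopBox.gamma_le_box_c56b_100 ha (fun j => h j.succ) hreg).trans (by norm_num)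
    · exact (TopBox.gamma_le_box_a49_100 ha (fun j => h j.succ) hreg).trans (by norm_num)
  · exact (gamma_le_appatchS ha hreg hq).trans (by norm_num)

end APPatch

end Summit.KontsevichZagierPeriods.Zeta5Search.Barrier.ConeGamma

end
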